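import Summits.HubbardSuperconductivity.HubbardSuperconductivity.Theorems.SoloBlindDiamondFermiSea
import Summits.Ventures.CertifiedManyBodySolver.Observables.NeelClassFloorTraces
import HarnessLib

/-!
# Ventures/CertifiedManyBodySolver — Observables/NeelClassFloorAbsBand.lean
# The EXACT first absolute band moment on the even torus: `Σ_k |ε_k| = 16/sin²(π/L) − 8 ≤ 1.6212·L²`

HONEST FRAMING: first certified bounds; not a superconductivity verdict; every number certified or labelled float.

Cell `hubbard-tc` (MO-S3), seat `hubbard-tc-mod-3` (G3), `prover-hubbard-tc-mod-3-g8-0`. §E W3-11b′ of the seat's EXCLUSION-TABLE: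
the Néel-class kinetic floors (`NeelClassFloorQuad/Cubic.lean`) read the SDW band sum `Σ_k √(ε_k² + Δ²)` through polynomial
majorants in `x = ε²` and the exact even moments `Σε² = 4L²`, `Σε⁴ = 36L²`, `Σε⁶ = 400L²`; their residual loss is the polynomial's at the
KINK of `|ε|` (0.09·t at Δ = 0.3). This file supplies the kink itself: on the torus `(ℤ/Lℤ)²` with `L` even,

* `torusBand_neg_of_two_mul_lt` / `torusBand_nonneg_of_le_two_mul` — the SIGN of `ε_L(k) = −2(cos p₀ + cos p₁)` is decided by the
  lattice diamond: with `v_i = |k_i|` (least absolute residue), `ε_L(k) < 0` if `2(v₀ + v₁) < L` and `ε_L(k) ≥ 0` if `2(v₀ + v₁) ≥ L`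
  (`cos a + cos b > 0 ⟺ a + b < π` on `[0, π]²`);
* `mem_diamondSet_iff` — the solo-blind residency's embedded diamond `diamondSet L K` (`SoloBlindDiamondFermiSea.lean`) is
  `{k : v₀ + v₁ ≤ K}` (`2K + 1 ≤ L`);
* `sum_abs_torusBand` — **`Σ_k |ε_L(k)| = 16/sin²(π/L) − 8`** (`L ≥ 4` even): split by the diamond `K = L/2 − 1`, the band sums to zero
  (`sum_compl_torusBand_eq_neg`), the diamond sum is `−2 S_K(2π/L)` (`sum_diamondSet_torusBand`) and
  `sin²(π/L)·S_K(2π/L) = 2 sin²(π/L) + 4 cos²(π/L)` (`sin_sq_mul_diamondSum`);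
* `sum_abs_torusBand_le` — **`Σ_k |ε_L(k)| ≤ 1.6212·L²`** for even `L ≥ 6` (`16/π² = 1.62114`; `Real.sin_bound`), and the `siteBand` form
  `sum_abs_siteBand_le`: `Σ_k |ε_t(k)| ≤ 1.6212·|t|·L²` on the fermionic torus — the input of the `|ε|`-majorant floors (successor file).

Everything is PROVED; no definition, no `sorry`. References: S. Friedli, Y. Velenik (2017) §10.4 (lattice Fourier sums) [FriedliVelenik2017];
J. S. Langer, D. C. Mattis, Phys. Lett. 36A (1971) 139, eq. (3) [LangerMattis1971].
-/

noncomputable section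

namespace Summit.Ventures.CertifiedManyBodySolver.Observables

namespace NeelClassFloor

open Real Finset Literature.Probability.LatticeModels Literature.MathematicalPhysics.QuantumLattice
  Literature.MathematicalPhysics.QuantumLattice.LangerMattis
open Summit.HubbardSuperconductivity.HubbardSuperconductivity.Theorems.WeakCouplingSpin

variable {L : ℕ} [NeZero L]

/-! ### Least absolute residues and the lattice cosines -/

/-- The lattice cosine depends only on the least absolute residue: `cos(2π k.val/L) = cos(2π|k|/L)` with
`|k| = k.valMinAbs.natAbs`. [cite: FriedliVelenik2017, §10.4] -/
theorem cos_latticeMomentum_eq_cos_natAbs {d : ℕ} (k : TorusSite d L) (i : Fin d) :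
    Real.cos (latticeMomentum L k i) = Real.cos (2 * π * (((k i).valMinAbs.natAbs : ℕ) : ℝ) / L) := by
  have hL : (L : ℝ) ≠ 0 := Nat.cast_ne_zero.mpr (NeZero.ne L)
  rw [latticeMomentum_eq, Nat.cast_natAbs, Int.cast_abs]
  have hval : (((k i).val : ℕ) : ℝ) = (((k i).val : ℤ) : ℝ) := by push_cast; rfl
  rw [hval, ZMod.val_eq_ite_valMinAbs (k i)]
  have habs : Real.cos (2 * π * |(((k i).valMinAbs : ℤ) : ℝ)| / L) =
      Real.cos (2 * π * (((k i).valMinAbs : ℤ) : ℝ) / L) := by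
    rw [show 2 * π * |(((k i).valMinAbs : ℤ) : ℝ)| / L = |2 * π * (((k i).valMinAbs : ℤ) : ℝ) / L| by
      rw [abs_div, abs_mul, abs_of_pos (by positivity : (0:ℝ) < 2 * π), abs_of_pos (by positivity : (0:ℝ) < L)],
      Real.cos_abs]
  rw [habs]
  split_ifs with h
  · simp
  · push_cast
    rw [show 2 * π * (((k i).valMinAbs : ℝ) + (L : ℝ)) / L = 2 * π * ((k i).valMinAbs : ℝ) / L + ((1 : ℤ) : ℝ) * (2 * π) by
      field_simp; ring, Real.cos_add_int_mul_two_pi]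

/-- `2|k| ≤ L`, hence the reduced lattice angle `2π|k|/L` lies in `[0, π]`. [folklore] -/
theorem two_pi_mul_natAbs_div_le_pi (k : ZMod L) :
    2 * π * ((k.valMinAbs.natAbs : ℕ) : ℝ) / L ≤ π := by
  have hL : (0 : ℝ) < L := by exact_mod_cast Nat.pos_of_ne_zero (NeZero.ne L)
  have h := k.natAbs_valMinAbs_le
  have h2 : 2 * (k.valMinAbs.natAbs : ℝ) ≤ L := by
    have : 2 * k.valMinAbs.natAbs ≤ L := by omega
    exact_mod_cast this
  rw [div_le_iff₀ hL]
  nlinarith [pi_pos]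

/-! ### The sign of the band is decided by the diamond -/

/-- **Inside the open diamond the band is negative**: if `2(|k₀| + |k₁|) < L` then `ε_L(k) < 0`
(`a + b < π` on `[0,π]²` ⇒ `cos b > cos(π − a) = −cos a`). [cite: LangerMattis1971, eq. (3)] -/
theorem torusBand_neg_of_two_mul_lt (k : TorusSite 2 L)
    (h : 2 * ((k 0).valMinAbs.natAbs + (k 1).valMinAbs.natAbs) < L) : torusBand L k < 0 := by
  have hL : (0 : ℝ) < L := by exact_mod_cast Nat.pos_of_ne_zero (NeZero.ne L)
  simp only [torusBand, Fin.sum_univ_two]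
  rw [cos_latticeMomentum_eq_cos_natAbs, cos_latticeMomentum_eq_cos_natAbs]
  set a := 2 * π * (((k 0).valMinAbs.natAbs : ℕ) : ℝ) / L with ha
  set b := 2 * π * (((k 1).valMinAbs.natAbs : ℕ) : ℝ) / L with hb
  have ha0 : 0 ≤ a := by rw [ha]; positivity
  have hb0 : 0 ≤ b := by rw [hb]; positivity
  have hab : a + b < π := by
    have h' : 2 * (((k 0).valMinAbs.natAbs : ℝ) + ((k 1).valMinAbs.natAbs : ℝ)) < L := by exact_mod_cast h
    rw [ha, hb, ← add_div, div_lt_iff₀ hL]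
    nlinarith [pi_pos]
  have hlt : Real.cos (π - a) < Real.cos b :=
    Real.cos_lt_cos_of_nonneg_of_le_pi hb0 (by linarith) (by linarith)
  rw [Real.cos_pi_sub] at hlt
  linarith

/-- **Outside the open diamond the band is nonnegative**: if `L ≤ 2(|k₀| + |k₁|)` then `0 ≤ ε_L(k)`. [cite: LangerMattis1971, eq. (3)] -/
theorem torusBand_nonneg_of_le_two_mul (k : TorusSite 2 L)
    (h : L ≤ 2 * ((k 0).valMinAbs.natAbs + (k 1).valMinAbs.natAbs)) : 0 ≤ torusBand L k := by
  have hL : (0 : ℝ) < L := by exact_mod_cast Nat.pos_of_ne_zero (NeZero.ne L)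
  simp only [torusBand, Fin.sum_univ_two]
  rw [cos_latticeMomentum_eq_cos_natAbs, cos_latticeMomentum_eq_cos_natAbs]
  set a := 2 * π * (((k 0).valMinAbs.natAbs : ℕ) : ℝ) / L with ha
  set b := 2 * π * (((k 1).valMinAbs.natAbs : ℕ) : ℝ) / L with hb
  have haπ : a ≤ π := two_pi_mul_natAbs_div_le_pi (k 0)
  have hbπ : b ≤ π := two_pi_mul_natAbs_div_le_pi (k 1)
  have hab : π ≤ a + b := by
    have h' : (L : ℝ) ≤ 2 * (((k 0).valMinAbs.natAbs : ℝ) + ((k 1).valMinAbs.natAbs : ℝ)) := by exact_mod_cast h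
    rw [ha, hb, ← add_div, le_div_iff₀ hL]
    nlinarith [pi_pos]
  have hle : Real.cos b ≤ Real.cos (π - a) :=
    Real.cos_le_cos_of_nonneg_of_le_pi (by linarith) hbπ (by linarith)
  rw [Real.cos_pi_sub] at hle
  linarith

/-! ### The embedded diamond is `{|k₀| + |k₁| ≤ K}` -/

/-- **Membership in the embedded diamond** (`2K + 1 ≤ L`): `k ∈ diamondSet L K ↔ |k₀| + |k₁| ≤ K` with `|k_i|` the least absolute
residue. [cite: FriedliVelenik2017, §10.4] -/
theorem mem_diamondSet_iff {K : ℕ} (hK : 2 * K + 1 ≤ L) (k : TorusSite 2 L) :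
    k ∈ diamondSet L K ↔ (k 0).valMinAbs.natAbs + (k 1).valMinAbs.natAbs ≤ K := by
  constructor
  · intro hk
    rw [diamondSet, Finset.mem_image] at hk
    obtain ⟨p, hp, rfl⟩ := hk
    have hp' := Finset.mem_filter.1 hp
    have hr : p.1 < 2 * K + 1 ∧ p.2 < 2 * K + 1 := by simpa [Finset.mem_product] using hp'.1
    obtain ⟨h1, h2, h3, h4⟩ := hp'.2
    have hv : ∀ s : ℕ, s < 2 * K + 1 →
        ((((s : ℤ) - K : ℤ) : ZMod L)).valMinAbs = (s : ℤ) - K := by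
      intro s hs
      rw [ZMod.valMinAbs_spec]
      refine ⟨rfl, ?_, ?_⟩ <;> omega
    have e0 : (diamondEmb L K p 0) = (((p.1 : ℤ) - K : ℤ) : ZMod L) := rfl
    have e1 : (diamondEmb L K p 1) = (((p.2 : ℤ) - K : ℤ) : ZMod L) := rfl
    rw [e0, e1, hv p.1 hr.1, hv p.2 hr.2]
    omega
  · intro hk
    rw [diamondSet, Finset.mem_image]
    refine ⟨(((k 0).valMinAbs + K).toNat, ((k 1).valMinAbs + K).toNat), ?_, ?_⟩
    · rw [diamondN, Finset.mem_filter, Finset.mem_product, Finset.mem_range, Finset.mem_range]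
      omega
    · have h0 : ((((k 0).valMinAbs + K).toNat : ℕ) : ℤ) - K = (k 0).valMinAbs := by omega
      have h1 : ((((k 1).valMinAbs + K).toNat : ℕ) : ℤ) - K = (k 1).valMinAbs := by omega
      funext i
      fin_cases i
      · show (((( ((k 0).valMinAbs + K).toNat : ℕ) : ℤ) - K : ℤ) : ZMod L) = k 0
        rw [h0, ZMod.coe_valMinAbs]
      · show (((( ((k 1).valMinAbs + K).toNat : ℕ) : ℤ) - K : ℤ) : ZMod L) = k 1
        rw [h1, ZMod.coe_valMinAbs]

/-! ### The exact first absolute moment -/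

/-- **`Σ_k |ε_L(k)| = 16/sin²(π/L) − 8` on the even torus** (`L ≥ 4`): the negative levels are exactly the open diamond
`|k₀| + |k₁| ≤ L/2 − 1`, the band sums to zero, and the diamond sum is the solo-blind closed form
`sin²(π/L)·S_{L/2−1}(2π/L) = 2 sin²(π/L) + 4 cos²(π/L)`. Per site this is `16/(L² sin²(π/L)) − 8/L² ↑ 16/π² = 1.6211` (1.582 at `L = 8`).
[cite: FriedliVelenik2017, §10.4] -/
theorem sum_abs_torusBand (hLe : Even L) (hL4 : 4 ≤ L) :
    ∑ k : TorusSite 2 L, |torusBand L k| = 16 / Real.sin (π / L) ^ 2 - 8 := by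
  classical
  obtain ⟨M, hM⟩ := hLe
  have hM2 : 2 ≤ M := by omega
  set K := M - 1 with hKdef
  have hK : 2 * K + 1 ≤ L := by omega
  have hL2 : 2 ≤ L := by omega
  have hLr : (0 : ℝ) < L := by exact_mod_cast (show 0 < L by omega)
  -- split the sum by the diamond
  set D := diamondSet L K with hD
  have hin : ∀ k ∈ D, |torusBand L k| = -torusBand L k := by
    intro k hk
    have hk' := (mem_diamondSet_iff hK k).1 hk
    exact abs_of_neg (torusBand_neg_of_two_mul_lt k (by omega))
  have hout : ∀ k ∈ Dᶜ, |torusBand L k| = torusBand L k := by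
    intro k hk
    rw [Finset.mem_compl] at hk
    have hk' : ¬ ((k 0).valMinAbs.natAbs + (k 1).valMinAbs.natAbs ≤ K) := fun h => hk ((mem_diamondSet_iff hK k).2 h)
    exact abs_of_nonneg (torusBand_nonneg_of_le_two_mul k (by omega))
  have hsplit := (Finset.sum_add_sum_compl D fun k => |torusBand L k|).symm
  rw [Finset.sum_congr rfl hin, Finset.sum_congr rfl hout, Finset.sum_neg_distrib,
    sum_compl_torusBand_eq_neg hL2 D, hD, sum_diamondSet_torusBand hK] at hsplit
  rw [hsplit]
  -- the closed form of the diamond sum at K = L/2 - 1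
  have hid := sin_sq_mul_diamondSum K (2 * π / L)
  have hx : 2 * π / L / 2 = π / L := by ring
  have hKr : (K : ℝ) = (L : ℝ) / 2 - 1 := by
    have : (K : ℝ) = (M : ℝ) - 1 := by rw [hKdef, Nat.cast_sub (by omega)]; simp
    rw [this, hM]; push_cast; ring
  have h1 : (2 * (K : ℝ) + 1) * (2 * π / L) / 2 = π - π / L := by rw [hKr]; field_simp; ring
  have h2 : (K : ℝ) * (π / L) = π / 2 - π / L := by rw [hKr]; field_simp
  rw [hx, h1, h2, Real.sin_pi_sub, Real.sin_pi_div_two_sub] at hid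
  have hs : 0 < Real.sin (π / L) := by
    refine Real.sin_pos_of_pos_of_lt_pi (by positivity) ?_
    rw [div_lt_iff₀ hLr]; nlinarith [pi_pos, (show (4:ℝ) ≤ L by exact_mod_cast hL4)]
  have hc : Real.cos (π / L) ^ 2 = 1 - Real.sin (π / L) ^ 2 := by rw [Real.cos_sq']
  have hS : diamondSum K (2 * π / L) = (2 * Real.sin (π / L) ^ 2 + 4 * (1 - Real.sin (π / L) ^ 2)) / Real.sin (π / L) ^ 2 := by
    rw [eq_div_iff (pow_pos hs 2).ne']
    nlinarith [hid, hc]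
  rw [hS]
  field_simp
  ring

/-- **`Σ_k |ε_L(k)| ≤ 1.6212·L²` for even `L ≥ 6`** (`16/π² = 1.62114`; `sin x ≥ x − x³/6 − x⁵/100` for `x = π/L ≤ π/6`).
[cite: FriedliVelenik2017, §10.4] -/
theorem sum_abs_torusBand_le (hLe : Even L) (hL6 : 6 ≤ L) :
    ∑ k : TorusSite 2 L, |torusBand L k| ≤ 1.6212 * (L : ℝ) ^ 2 := by
  rw [sum_abs_torusBand hLe (by omega)]
  have hLr : (6 : ℝ) ≤ L := by exact_mod_cast hL6
  have hL0 : (0 : ℝ) < L := by linarith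
  set x := π / L with hxdef
  have hx0 : 0 < x := by rw [hxdef]; positivity
  have hxpi : x * L = π := by rw [hxdef]; field_simp
  have hx1 : x ≤ 0.5236 := by
    rw [hxdef, div_le_iff₀ hL0]; nlinarith [Real.pi_lt_d4]
  have hsb := Real.sin_bound (show |x| ≤ 1 by rw [abs_of_pos hx0]; linarith)
  rw [abs_of_pos hx0] at hsb
  have hs_lo : x - x ^ 3 / 6 - x ^ 5 / 100 ≤ Real.sin x := by
    have := (abs_le.1 hsb).1; linarith
  have hu : x ^ 2 ≤ 0.2742 := by nlinarith
  have h5 : x ^ 5 ≤ 0.2742 * x ^ 3 := by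
    calc x ^ 5 = x ^ 3 * x ^ 2 := by ring
      _ ≤ x ^ 3 * 0.2742 := by gcongr
      _ = 0.2742 * x ^ 3 := by ring
  have hq : x * (1 - 0.17 * x ^ 2) ≤ Real.sin x := by nlinarith [pow_pos hx0 3]
  have hq0 : 0 ≤ x * (1 - 0.17 * x ^ 2) := by nlinarith
  have hs2 : (x * (1 - 0.17 * x ^ 2)) ^ 2 ≤ Real.sin x ^ 2 := pow_le_pow_left₀ hq0 hq 2
  have hspos : 0 < Real.sin x := by
    refine Real.sin_pos_of_pos_of_lt_pi hx0 ?_; linarith [Real.pi_gt_three]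
  have hs1 : Real.sin x ^ 2 ≤ 1 := Real.sin_sq_le_one x
  rw [div_sub' (pow_ne_zero 2 hspos.ne'), div_le_iff₀ (pow_pos hspos 2)]
  -- 16 - 8 sin² ≤ 1.6212 L² sin², with L = π/x and π² > 9.8695
  have hpi : 9.8695 < π ^ 2 := by nlinarith [Real.pi_gt_d6, Real.pi_pos]
  have hL2 : (L : ℝ) ^ 2 * x ^ 2 = π ^ 2 := by rw [← hxpi]; ring
  have hA : 1.6212 * π ^ 2 * (1 - 0.17 * x ^ 2) ^ 2 ≤ 1.6212 * (L : ℝ) ^ 2 * Real.sin x ^ 2 := by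
    have h := mul_le_mul_of_nonneg_left hs2 (show (0:ℝ) ≤ 1.6212 * (L : ℝ) ^ 2 by positivity)
    have e : 1.6212 * (L : ℝ) ^ 2 * (x * (1 - 0.17 * x ^ 2)) ^ 2 = 1.6212 * π ^ 2 * (1 - 0.17 * x ^ 2) ^ 2 := by
      rw [← hL2]; ring
    linarith [h, e]
  have hw : 1 - 0.34 * x ^ 2 ≤ (1 - 0.17 * x ^ 2) ^ 2 := by nlinarith [sq_nonneg (x ^ 2)]
  have hC : 9.8695 * (1 - 0.17 * x ^ 2) ^ 2 ≤ π ^ 2 * (1 - 0.17 * x ^ 2) ^ 2 :=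
    mul_le_mul_of_nonneg_right hpi.le (sq_nonneg _)
  have hF : x ^ 4 ≤ 0.2742 * x ^ 2 := by
    calc x ^ 4 = x ^ 2 * x ^ 2 := by ring
      _ ≤ x ^ 2 * 0.2742 := by gcongr
      _ = 0.2742 * x ^ 2 := by ring
  have hB : 16 - Real.sin x ^ 2 * 8 ≤ 16 - 8 * (x * (1 - 0.17 * x ^ 2)) ^ 2 := by linarith [hs2]
  have hB' : 16 - 8 * (x * (1 - 0.17 * x ^ 2)) ^ 2 ≤ 16 - 8 * x ^ 2 + 2.72 * x ^ 4 := by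
    nlinarith [mul_le_mul_of_nonneg_left hw (sq_nonneg x)]
  have hA' : 16.0004 * (1 - 0.34 * x ^ 2) ≤ 1.6212 * π ^ 2 * (1 - 0.17 * x ^ 2) ^ 2 := by
    nlinarith [hC, hw]
  nlinarith [hA, hA', hB, hB', hF]

/-! ### The `siteBand` form on the fermionic torus -/

omit [NeZero L] in
/-- `ε_t(k) = −t·ε_L(k)`: the fermionic-torus band `siteBand t` is `−t` times `torusBand`. [cite: LangerMattis1971, eq. (3)] -/
theorem siteBand_eq_neg_mul_torusBand (t : ℝ) (k : FermionTorus 2 L) :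
    siteBand t k = -t * torusBand L k.toTorusSite := by
  rw [siteBand, torusBand]
  ring

/-- **`Σ_k |ε_t(k)| ≤ 1.6212·|t|·L²`** on the fermionic torus `(ℤ/Lℤ)²`, `L ≥ 6` even — the `|ε|`-moment input of the absolute-value
majorant floors. [cite: LangerMattis1971, eq. (3)] -/
theorem sum_abs_siteBand_le (hLe : Even L) (hL6 : 6 ≤ L) (t : ℝ) :
    ∑ k : FermionTorus 2 L, |siteBand t k| ≤ 1.6212 * |t| * (L : ℝ) ^ 2 := by
  have h : ∑ k : FermionTorus 2 L, |siteBand t k| = |t| * ∑ z : TorusSite 2 L, |torusBand L z| := by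
    rw [FermionTorus.sum_eq_sum_torusSite, Finset.mul_sum]
    refine Finset.sum_congr rfl fun z _ => ?_
    rw [siteBand_eq_neg_mul_torusBand, FermionTorus.toTorusSite_ofTorusSite, abs_mul, abs_neg]
  rw [h]
  have := sum_abs_torusBand_le (L := L) hLe hL6
  nlinarith [abs_nonneg t]

/-- The exact per-site value in `siteBand` form: `Σ_k |ε_t(k)| = |t|(16/sin²(π/L) − 8)` (`L ≥ 4` even). [cite: LangerMattis1971, eq. (3)] -/
theorem sum_abs_siteBand (hLe : Even L) (hL4 : 4 ≤ L) (t : ℝ) :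
    ∑ k : FermionTorus 2 L, |siteBand t k| = |t| * (16 / Real.sin (π / L) ^ 2 - 8) := by
  rw [← sum_abs_torusBand hLe hL4, FermionTorus.sum_eq_sum_torusSite, Finset.mul_sum]
  refine Finset.sum_congr rfl fun z _ => ?_
  rw [siteBand_eq_neg_mul_torusBand, FermionTorus.toTorusSite_ofTorusSite, abs_mul, abs_neg]

end NeelClassFloor

end Summit.Ventures.CertifiedManyBodySolver.Observables

end
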